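import Literature.AlgebraicGeometry.Milne1999.LefschetzGroup
import Literature.AlgebraicGeometry.HodgeTheory.WeilClassesCMReductionProductForm
import HarnessLib

/-!
# The stabiliser `G^W` of the divisor classes and the split Weil classes on the powers of a CM product, and Deligne's `G^H = G^W` (Milne 2020, Thm. 2), Tannaka-free

Family `hodge`, layer `Literature/AlgebraicGeometry/Milne1999`, namespace
`Literature.AlgebraicGeometry.Milne1999` (D-0022). Written for the cell `pub-hodgecm2` (COR-CM, Hodge
ladder stage 2), literature fan-out plan `HOME/lit/LIT-FANOUT-PLAN.md` §B **INFRA-12-1′** ("group fixing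
all classes on all powers — Tannakian statements without Tannakian categories: Milne CM-notes D Thm 2
`G^H = G^W`, Deligne §3"; binder table `HOME/lit/milne.md` row M16: "not typed: the Tannakian-group
statement 'algebraic subgroup of `GL(H¹)` fixing classes on all products of powers' has no tree
carrier"). The carrier now exists: `HodgeTheory.powClassStabilizer` (`HodgeTheory/MotivatedGaloisGroup`)
and the Lefschetz system `lefschetzPowClasses` (`Milne1999/LefschetzGroup`). Source read (held text
`paper:arxiv-2010.08857`, J. S. Milne, *Hodge classes on abelian varieties* (2020), §4 "Deligne's original
version of Theorem 1", chunk p0006), verbatim: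

* "Let `E` be a CM-field Galois over `ℚ`, and let `𝒮` be the set of CM-types on `E`. For each `Φ ∈ 𝒮`
  choose an abelian variety `A_Φ` of CM-type `(E,Φ)`, and let `A_𝒮 = ∏_{Φ∈𝒮} A_Φ`. Define `G^H` (resp.
  `G^W`) to be the algebraic subgroup of `GL_{H¹(A_𝒮,ℚ)}` fixing all Hodge classes (resp. divisor classes
  and split Weil classes) on all products of powers of the `A_Φ`, `Φ ∈ 𝒮`.
  **Theorem 2.** The algebraic groups `G^H` and `G^W` are equal.
  *Proof.* As divisor classes and Weil classes are Hodge classes, certainly `G^H ⊂ G^W`. On the other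
  hand, the graphs of homomorphisms of abelian varieties are in the `ℚ`-algebra generated by divisor
  classes (Milne 1999, 5.6), and so, with the notation of Theorem 1, `G^W` fixes the elements of
  `f_Δ^*(W_F(A_Δ))`. As these span the Hodge classes, we deduce that `G^W ⊂ G^H`.
  **Remark.** Theorem 2 is Deligne's original theorem (1982, 5) except that, instead of requiring `G^W`
  to fix all divisor classes, he requires it to fix certain specific homomorphisms."
* Theorem 1 [André 1992] (chunk p0005): "Let `A` be a complex abelian variety of CM-type. There exist
  abelian varieties `A_Δ` and homomorphisms `f_Δ : A → A_Δ` such that every Hodge class `t` on `A` can be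
  written as a sum `t = Σ f_Δ^*(t_Δ)` with `t_Δ` a Weil class on `A_Δ`", with, in the proof, `A_Δ =
  ∏_{s∈Δ} A_s` "equipped with the diagonal action of `F` […] of split Weil type" (2.2: a product of `2p`
  abelian varieties of CM-types `φ_i` of `F` with `Σ_i φ_i(s) = p` for all `s` is of split Weil type).

## Lean rendering (the tree's Tannaka-free house style)

The tree renders "the algebraic subgroup of `GL(H)` fixing the classes `𝒞` on all powers" on the REAL
CARRIERS `complexBetti X k = Hᵏ(X(ℂ); ℂ)` as `powClassStabilizer X 𝒞`: the subgroup of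
`∏ₖ GL(Hᵏ(X(ℂ); ℂ))` of the families `g` whose Künneth (diagonal) extension to the powers
`X^{×(a+1)} = cartesianPow X (a + 1)` fixes every class of the system `𝒞 = (𝒞_{a,p} ⊆ H²ᵖ(X^{×(a+1)}))`;
with `𝒞` = the rational `(p,p)`-classes this is `hodgeGroup n X` — Milne's `G^H` ("fixing all Hodge
classes": no Tate character, i.e. the special Mumford–Tate group `Hg′`), with `𝒞` = the Lefschetz classes
it is `Milne1999.specialLefschetzGroup n X = S(A)`. The source variety is, as in the tree's PRODUCT FORM of
André's theorem (`HodgeTheory.Andre1992_hodgeClasses_cmTypedProduct_mem_span_pullback_weilLines`, file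
`HodgeTheory/WeilClassesCMReductionProductForm`), a product `B = ⨁_{i<n} A_i` of abelian varieties
`(A_i, ι_i, θ_i)` realising CM types `Φ_i` of ONE CM field `K`, Galois over `ℚ`
(`ComplexMultiplication.IsCMTypeRealisation`) — Milne's `A_𝒮` is the case "`Φ` runs through all CM types
of `K = E`". This file defines, for such a family `(A, Φ, ι)` and an (intended smooth projective,
`m`-dimensional) `X`:

* `weilPullbackClasses A Φ ι Y p ⊆ H²ᵖ(Y(ℂ); ℂ)` — the PULLED-BACK SPLIT WEIL CLASSES on a `ℂ`-scheme `Y`: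
  the classes `g^* t` for `g : Y ⟶ B_Δ` a `ℂ`-morphism to a CONSTANT-SUM twisted slot product
  `B_Δ = ⨁_{j<2p} A_{i_j}` (`𝓞_K` acting on slot `j` through `ι_{i_j} ∘ 𝓞(e_j⁻¹)`, `e_j ∈ Aut(K)`,
  `#{j | s ∈ Φ_{i_j}^{e_j}} = p` for every `s : K → ℂ` — Milne's `A_Δ` "equipped with the diagonal action of
  `F`", of split Weil type by 2.2; exactly the targets and slot actions of the tree's André record) and `t` a
  RATIONAL class of Hodge type `(p,p)` in the `K`-Weil-line space `HodgeTheory.weilLineClasses … (2p)`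
  (`= W_K(B_Δ) ⊗ ℂ`, the tree's rendering of "`t_Δ` a Weil class on `A_Δ`");
* `weilPowClasses A Φ ι m X : (a, p) ↦ lefschetzPowClasses m X a p ∪ weilPullbackClasses A Φ ι X^{×(a+1)} p`
  — "divisor classes and split Weil classes on all […] powers";
* **`weilStabilizer A Φ ι m X := powClassStabilizer X (weilPowClasses A Φ ι m X)`** — `G^W(ℂ)` for
  `X = B.X`, `m = B.dim` — and its similitude form `weilSimilitudeGroup` (classes fixed up to the Tate
  character `cᵖ`, the `GL × 𝔾_m` convention of Milne 1999 Def. 4.3, to be compared with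
  `mumfordTateGroup`).

PROVED here, with NO new named fact (D-0026: net debt 0):
* `weilPullbackClasses_subset_hodgeClasses`, `weilPowClasses_subset_span_hodgePowClasses` — "As divisor
  classes and Weil classes are Hodge classes": pull-backs of rational `(p,p)`-classes along morphisms of
  smooth projective varieties are rational `(p,p)`-classes (`IsRationalClass.pullback`,
  `IsOfHodgeType.map_of_isSmoothProjective`), and Lefschetz classes lie in the span of the Hodge classes
  (`lefschetzPowClasses_subset_span_hodgePowClasses`);
* **`hodgeGroup_le_weilStabilizer`** ("certainly `G^H ⊂ G^W`") and **`weilStabilizer_le_specialLefschetzGroup`**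
  (`G^W ≤ S(A)`: `G^W` fixes in particular all Lefschetz classes), for every smooth projective `X`; the
  same in the `GL × 𝔾_m` convention (`mumfordTateGroup_le_weilSimilitudeGroup`,
  `weilSimilitudeGroup_le_lefschetzGroup`);
* **Theorem 2, `hodgeGroup_eq_weilStabilizer`**: for `X = B.X`, `B = ⨁_{i<n} A_i` a product of CM-typed
  realisations over one Galois CM field `K`, **`G^H = G^W`** — i.e.
  `hodgeGroup B.dim B.X = weilStabilizer A Φ ι B.dim B.X` — GRANTED the tree's André record
  `(h𝔄 : HodgeTheory.Andre1992_hodgeClasses_cmTypedProduct_mem_span_pullback_weilLines)` (Milne's "with the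
  notation of Theorem 1 […] As these span the Hodge classes"), which is DISCHARGED in the tree
  (`Summit.HodgeConjecture.CorCM.AndreProductForm.andre1992_hodgeClasses_cmTypedProduct_mem_span_pullback_weilLines_holds`,
  cell file `Summits/HodgeConjecture/CorCM/AndreProductFormHolds.lean`; a `Literature` file may not import
  `Summits`, so the record is threaded as a hypothesis and fed by consumers); and
  `mumfordTateGroup_eq_weilSimilitudeGroup` (the `GL × 𝔾_m` form). The proof applies the record to EVERY
  POWER `B^{a+1}`: `B^{a+1} = B.powSucc a` is isomorphic, as an abelian variety, to the flat biproduct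
  `⨁_{j < (a+1)n} A_{κ j}` (`powFlatIso`, built from the universal property of the iterated product —
  `powProj`, `powLift` — and Mathlib's `biproduct.reindex` along `finProdFinEquiv`), rational
  `(p,p)`-classes transport along the isomorphism (pull-back both ways), the record on the flat family gives
  generators `f_Δ^* t`, and `ψ^*(f_Δ^* t) = (ψ ≫ f_Δ)^* t` is a generator of `weilPullbackClasses` on
  `B^{a+1}` (`hodgeClasses_subset_span_weilPullbackClasses_of_iso`,
  `hodgePowClasses_subset_span_weilPowClasses`).

## Identification with the printed groups (what a reviewer must accept; not formalised)

Let `B = ⨁_{i<n} A_i` be as above, `V = H¹(B(ℂ), ℚ)`. (i) Milne's `G^W` is cut out of `GL(V)`; in the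
house rendering (module docstrings of `HodgeTheory/MotivatedGaloisGroup`, (c), and of
`Milne1999/LefschetzGroup`, (i)–(ii)) an element `γ ∈ G^W(ℂ)` acts on `H^*(B^{a+1}(ℂ); ℂ) = ⋀^*((a+1) V_ℂ^∨)`
through a Künneth family, and "fixes the divisor classes on all powers" is, `γ` being multiplicative, "fixes
all Lefschetz classes", the system `lefschetzPowClasses` (as in Milne 1999 Def. 4.3, `D_hom = ℚ[C¹]`).
(ii) The PULL-BACKS are built into the system: Milne's `G^W` fixes the split Weil classes `t` ON the
products of powers `A_Δ` and is then SHOWN (Milne 1999 Cor. 5.6: graphs of homomorphisms are Lefschetz,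
whence `G^W` commutes with `f_Δ^*`) to fix `f_Δ^* t`; the Künneth-family formalism has no push-forwards,
so no correspondences, and cannot replay Cor. 5.6 — instead `weilPowClasses` contains the classes `g^* t`
for ALL `ℂ`-morphisms `g : B^{a+1} ⟶ B_Δ` directly. This is the same subgroup: a morphism of varieties from
an abelian variety to an abelian variety is a translate of a homomorphism (rigidity, Mumford §4 Cor. 1) and
translations act trivially on cohomology (`B(ℂ)` is connected), so `{g^* t} = {h^* t | h a homomorphism}`,
and `G^W(ℂ)` fixes the latter by Milne's argument; conversely `weilStabilizer ≤ G^W(ℂ)` trivially (take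
`g` = identity of a slot product realised inside a power, or use Theorem 2 on both sides). (iii) The slot
products: Milne's `A_Δ = ∏_{s∈Δ} A_s`, `A_s = A ⊗_{E,s} F`, is, for `A = B`, `E = Kⁿ`, `F = K`, `s = (i, g)`,
the variety `A_i` with `b ∈ K` acting through `ι_i(g⁻¹ b)` (module docstring of
`WeilClassesCMReductionProductForm`): a product of members of the family with the diagonal TWISTED action,
of split Weil type by Milne 2.2 — so its `K`-Weil classes are "split Weil classes on a product of powers of
the `A_Φ`" in Milne's sense (for `B = A_𝒮`, `A_Φ` with the action twisted by `g` is moreover `K`-isogenous to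
the member `A_{gΦ}`, Shimura–Taniyama; not needed). (iv) `ℂ`-spans versus `ℚ`-structures and `G(ℂ)`
versus `G`: as in `Milne1999/LefschetzGroup` (iii)–(iv) (`powClassStabilizer_span`; `G(ℂ)` determines `G`).
Under (i)–(iv), `hodgeGroup_eq_weilStabilizer` is Theorem 2 for `A_𝒮` (and, more generally, for every
CM-typed product `B` over one Galois CM field), on `ℂ`-points.

## Design and what is NOT here

* The CM family enters only through `(A, Φ, ι)`: the varieties, their CM types (for the constant-sum
  condition selecting the split-Weil-type slot products) and their `𝓞_K`-actions (for the twisted diagonal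
  actions defining the `K`-Weil lines); `θ` and the realisation hypotheses enter Theorem 2 only.
* `weilPullbackClasses A Φ ι Y p` is defined for an ARBITRARY `ℂ`-scheme `Y` (pull-backs along all
  `ℂ`-morphisms `Y ⟶ B_Δ`), so that the system on the powers needs no transport along
  `(B.powSucc a).X = cartesianPow B.X (a + 1)` (`AbelianVariety.powSucc_X_eq_cartesianPow`); the abelian
  variety structure of the powers is used only inside the proof of Theorem 2.
* NOT here: Milne 1999 Cor. 5.6 (graphs are Lefschetz) and any push-forward; the `ℚ`-structure of `G^W`;
  reductivity; Deligne's variant with "certain specific homomorphisms" (Remark 1); André's Theorem 1 itself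
  (the record, discharged elsewhere in the tree); the consequences §5 of Milne 2020 (Thm. 3: algebraicity of
  split Weil classes ⟹ Hodge conjecture for CM abelian varieties — in the tree as
  `mem_algebraicClasses_cmTypedProduct_of_andre1992` and the cell's `HC_CM` arrows).
* Mathlib has no Mumford–Tate groups, abelian varieties, Hodge structures on varieties or Tannakian
  categories; everything rests on the tree's carriers (`lean search "weilStabilizer|WeilStabilizer"`: ∅).

## References

* [Milne2020HodgeClassesAV] J. S. Milne, Hodge classes on abelian varieties, arXiv:2010.08857 (2020): §4
  Theorem 2 with proof and Remark 1; Theorem 1 and its proof (the `A_Δ`, `f_Δ`); 2.1–2.2 (Weil classes,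
  split Weil type).
* [Deligne1982HodgeCycles] P. Deligne, Hodge cycles on abelian varieties (notes by J. S. Milne), LNM 900
  (1982), §5 (the original form of Theorem 2) and endnote M.12.
* [Milne1999LefschetzClasses] J. S. Milne, Lefschetz classes on abelian varieties, Duke Math. J. 96 (1999):
  Def. 4.3, p. 660 (`Hg`, `L`), Cor. 5.6 (graphs are Lefschetz).
* [Andre1992HodgeCM] Y. André, Une remarque à propos des cycles de Hodge de type CM, Progr. Math. 102
  (1992) 1–7, §4 Théorème.
* [MumfordAV1970] D. Mumford, Abelian Varieties, §4 Cor. 1 (rigidity), §19 (`Hom(C, A × B)`).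
-/

noncomputable section

open CategoryTheory CategoryTheory.Limits MonoidalCategory NumberField
open Literature.AlgebraicTopology.SingularHomology
open Literature.AlgebraicGeometry.HodgeTheory
open Literature.AlgebraicGeometry.Motives
open Literature.AlgebraicGeometry.ComplexMultiplication
open Literature.Barriers.HodgeConjecture
open Literature.NumberTheory.Automorphic (PicardCM.CMCode.cmTypeMap)

namespace Literature.AlgebraicGeometry.Milne1999

/-! ### Powers of an abelian variety: the projections and the universal map of `B^{a+1} = B.powSucc a` -/

section Pow

universe u

variable {k : Type u} [Field k]

/-- The first projection `B^{a+2} = B^{a+1} × B ⟶ B^{a+1}` of the iterated product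
`B.powSucc (a + 1) = (B.powSucc a).prod B`, with its source SPELLED `B.powSucc (a + 1)` (the product
API of `Motives/AbelianVarietyProduct` spells it `(B.powSucc a).prod B`; the two agree by unfolding
`powSucc`, and fixing the spelling once here keeps every later rewrite syntactic). [cite: MumfordAV1970, §19 (Hom(C, A × B) = Hom(C, A) ⊕ Hom(C, B))] -/
def powFst (B : AbelianVariety k) (a : ℕ) : B.powSucc (a + 1) ⟶ B.powSucc a :=
  AbelianVariety.fst (B.powSucc a) B

/-- The last projection `B^{a+2} = B^{a+1} × B ⟶ B`, source spelled `B.powSucc (a + 1)`.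
[cite: MumfordAV1970, §19] -/
def powSnd (B : AbelianVariety k) (a : ℕ) : B.powSucc (a + 1) ⟶ B :=
  AbelianVariety.snd (B.powSucc a) B

/-- The pairing `(f, g) : T ⟶ B^{a+2} = B^{a+1} × B`, target spelled `B.powSucc (a + 1)`.
[cite: MumfordAV1970, §19] -/
def powPair {T B : AbelianVariety k} (a : ℕ) (f : T ⟶ B.powSucc a) (g : T ⟶ B) :
    T ⟶ B.powSucc (a + 1) :=
  AbelianVariety.prodLift f g

variable {T B : AbelianVariety k}

/-- `(f, g) ≫ fst = f`. [cite: MumfordAV1970, §19] -/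
@[reassoc (attr := simp)]
theorem powPair_powFst (a : ℕ) (f : T ⟶ B.powSucc a) (g : T ⟶ B) : powPair a f g ≫ powFst B a = f :=
  AbelianVariety.prodLift_fst f g

/-- `(f, g) ≫ snd = g`. [cite: MumfordAV1970, §19] -/
@[reassoc (attr := simp)]
theorem powPair_powSnd (a : ℕ) (f : T ⟶ B.powSucc a) (g : T ⟶ B) : powPair a f g ≫ powSnd B a = g :=
  AbelianVariety.prodLift_snd f g

/-- Two homomorphisms into `B^{a+2} = B^{a+1} × B` agree if their two components do.
[cite: MumfordAV1970, §19] -/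
theorem powSucc_hom_ext {a : ℕ} {f g : T ⟶ B.powSucc (a + 1)} (h₁ : f ≫ powFst B a = g ≫ powFst B a)
    (h₂ : f ≫ powSnd B a = g ≫ powSnd B a) : f = g :=
  AbelianVariety.prod_hom_ext h₁ h₂

/-- The `a + 1` projections `B^{a+1} ⟶ B` of the iterated product `B.powSucc a = (⋯(B × B) × ⋯) × B`
(the last factor is `powSnd`, the earlier ones factor through `powFst`). Milne's "products of powers of
the `A_Φ`" are read through these. [cite: MumfordAV1970, §19 (Hom(C, A × B) = Hom(C, A) ⊕ Hom(C, B))] -/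
def powProj (B : AbelianVariety k) : ∀ a : ℕ, Fin (a + 1) → (B.powSucc a ⟶ B)
  | 0 => fun _ ↦ 𝟙 B
  | a + 1 => Fin.snoc (fun r ↦ powFst B a ≫ powProj B a r) (powSnd B a)

/-- The universal map `(G_0, …, G_a) : T ⟶ B^{a+1}` of a family of homomorphisms `G_r : T ⟶ B`
(iterated pairing). [cite: MumfordAV1970, §19 (Hom(C, A × B) = Hom(C, A) ⊕ Hom(C, B))] -/
def powLift {T B : AbelianVariety k} : ∀ a : ℕ, (Fin (a + 1) → (T ⟶ B)) → (T ⟶ B.powSucc a)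
  | 0 => fun G ↦ G 0
  | a + 1 => fun G ↦ powPair a (powLift a fun r ↦ G r.castSucc) (G (Fin.last (a + 1)))

/-- On `B^{a+2} = B^{a+1} × B`, the last projection is `powSnd`. [cite: MumfordAV1970, §19] -/
theorem powProj_succ_last (B : AbelianVariety k) (a : ℕ) :
    powProj B (a + 1) (Fin.last (a + 1)) = powSnd B a := by
  simp only [powProj, Fin.snoc_last]

/-- On `B^{a+2} = B^{a+1} × B`, the earlier projections factor through `powFst`. [cite: MumfordAV1970, §19] -/
theorem powProj_succ_castSucc (B : AbelianVariety k) (a : ℕ) (r : Fin (a + 1)) :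
    powProj B (a + 1) r.castSucc = powFst B a ≫ powProj B a r := by
  simp only [powProj, Fin.snoc_castSucc]

/-- The unique projection of `B^{1} = B` is the identity. [cite: MumfordAV1970, §19] -/
theorem powProj_zero (B : AbelianVariety k) (r : Fin 1) : powProj B 0 r = 𝟙 B := rfl

/-- `(G_0, …, G_{a+1}) ≫ fst = (G_0, …, G_a)` on `B^{a+2} = B^{a+1} × B`. [cite: MumfordAV1970, §19] -/
theorem powLift_succ_powFst (a : ℕ) (G : Fin (a + 2) → (T ⟶ B)) :
    powLift (a + 1) G ≫ powFst B a = powLift a fun r ↦ G r.castSucc := by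
  simp only [powLift, powPair_powFst]

/-- `(G_0, …, G_{a+1}) ≫ snd = G_{a+1}` on `B^{a+2} = B^{a+1} × B`. [cite: MumfordAV1970, §19] -/
theorem powLift_succ_powSnd (a : ℕ) (G : Fin (a + 2) → (T ⟶ B)) :
    powLift (a + 1) G ≫ powSnd B a = G (Fin.last (a + 1)) := by
  simp only [powLift, powPair_powSnd]

/-- `(G_0, …, G_a) ≫ pr_r = G_r`. [cite: MumfordAV1970, §19] -/
theorem powLift_powProj : ∀ (a : ℕ) (G : Fin (a + 1) → (T ⟶ B)) (r : Fin (a + 1)),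
    powLift a G ≫ powProj B a r = G r
  | 0, G, r => by
    obtain rfl : r = 0 := Fin.eq_zero r
    exact Category.comp_id (G 0)
  | a + 1, G, r => by
    induction r using Fin.lastCases with
    | last => rw [powProj_succ_last, powLift_succ_powSnd]
    | cast r => rw [powProj_succ_castSucc, ← Category.assoc, powLift_succ_powFst, powLift_powProj a]

/-- Two homomorphisms into `B^{a+1}` with the same `a + 1` components are equal. [cite: MumfordAV1970, §19] -/
theorem pow_hom_ext : ∀ (a : ℕ) {f g : T ⟶ B.powSucc a},
    (∀ r : Fin (a + 1), f ≫ powProj B a r = g ≫ powProj B a r) → f = g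
  | 0, f, g, h => (Category.comp_id f).symm.trans ((h 0).trans (Category.comp_id g))
  | a + 1, f, g, h => by
    refine powSucc_hom_ext (pow_hom_ext a fun r ↦ ?_) ?_
    · have h' := h r.castSucc
      rw [powProj_succ_castSucc] at h'
      simp only [← Category.assoc] at h'
      exact h'
    · have h' := h (Fin.last (a + 1))
      rw [powProj_succ_last] at h'
      exact h'

end Pow

/-! ### The flattening isomorphism `(⨁_{i<n} A_i)^{a+1} ≅ ⨁_{j<(a+1)n} A_{κ j}` -/

section Flat

variable {n : ℕ} (A : Fin n → AbelianVariety ℂ) (a : ℕ)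

/-- The factor index `κ j ∈ Fin n` of the `j`-th slot of the flattened power, `j < (a+1) n`
(`j ↦ (r, i)` by `finProdFinEquiv`, `κ j = i`). [cite: MumfordAV1970, §19 (products of abelian varieties)] -/
def flatIndex (j : Fin ((a + 1) * n)) : Fin n := (finProdFinEquiv.symm j).2

/-- The power `(⨁_{i<n} A_i)^{a+1}` is isomorphic, as an abelian variety, to the biproduct of the family
`(r, i) ↦ A_i` over `Fin (a+1) × Fin n`: both are products of the same factors (universal properties of the
iterated product, `powProj`/`powLift`, and of the biproduct). [cite: MumfordAV1970, §19 (Hom(C, A × B) = Hom(C, A) ⊕ Hom(C, B))] -/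
def powProdIso : (⨁ A).powSucc a ≅ ⨁ fun q : Fin (a + 1) × Fin n ↦ A q.2 where
  hom := biproduct.lift fun q ↦ powProj (⨁ A) a q.1 ≫ biproduct.π A q.2
  inv := powLift a fun r ↦ biproduct.lift fun i ↦ biproduct.π (fun q : Fin (a + 1) × Fin n ↦ A q.2) (r, i)
  hom_inv_id := by
    refine pow_hom_ext a fun r ↦ ?_
    rw [Category.assoc, powLift_powProj, Category.id_comp]
    refine biproduct.hom_ext _ _ fun i ↦ ?_
    rw [Category.assoc, biproduct.lift_π, biproduct.lift_π]
  inv_hom_id := by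
    refine biproduct.hom_ext _ _ fun q ↦ ?_
    rw [Category.assoc, biproduct.lift_π, Category.id_comp, ← Category.assoc, powLift_powProj,
      biproduct.lift_π]

/-- **The flattening isomorphism** `(⨁_{i<n} A_i)^{a+1} ≅ ⨁_{j<(a+1)n} A_{κ j}` onto a biproduct indexed by
`Fin ((a+1) n)` — the shape on which the tree's André record is stated (`powProdIso` followed by Mathlib's
`biproduct.reindex` along `finProdFinEquiv`). [cite: MumfordAV1970, §19] -/
def powFlatIso : (⨁ A).powSucc a ≅ ⨁ fun j : Fin ((a + 1) * n) ↦ A (flatIndex a j) :=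
  powProdIso A a ≪≫ (biproduct.reindex finProdFinEquiv.symm (fun q : Fin (a + 1) × Fin n ↦ A q.2)).symm

end Flat

/-! ### Pulled-back split Weil classes and the system `G^W` fixes -/

section WeilSystem

variable {K : Type} [Field K]
variable {n : ℕ} (A : Fin n → AbelianVariety ℂ) (Φ : Fin n → CMType K) (ι : ∀ i, 𝓞 K →+* End (A i))

/-- **The pulled-back split Weil classes** on a `ℂ`-scheme `Y`, relative to the CM family
`(A_i, Φ_i, ι_i)_{i<n}` over `K`: the classes `g^* t ∈ H²ᵖ(Y(ℂ); ℂ)` where `g : Y ⟶ B_Δ` is a `ℂ`-morphism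
to a constant-sum twisted slot product `B_Δ = ⨁_{j<2p} A_{i_j}` — `𝓞_K` acting on slot `j` through
`ι_{i_j} ∘ 𝓞(e_j⁻¹)`, `#{j | s ∈ Φ_{i_j}^{e_j}} = p` for every embedding `s` (Milne's `A_Δ = ∏_{s∈Δ} A_s`
"equipped with the diagonal action of `F`", of split Weil type by 2.2; the targets of the tree's record
`Andre1992_hodgeClasses_cmTypedProduct_mem_span_pullback_weilLines`) — and `t` is a rational class of Hodge
type `(p,p)` in the `K`-Weil-line space `weilLineClasses … (2p) = W_K(B_Δ) ⊗ ℂ` ("`t_Δ` a Weil class on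
`A_Δ`"; "`G^W` fixes the elements of `f_Δ^*(W_F(A_Δ))`"). [cite: Milne2020HodgeClassesAV, §4 Theorem 2 (proof) and Theorem 1 (proof), 2.1–2.2] -/
def weilPullbackClasses (Y : Motives.SchemeOver ℂ) (p : ℕ) : Set (complexBetti Y (2 * p)) :=
  {x | ∃ (i : Fin (2 * p) → Fin n) (e : Fin (2 * p) → (K ≃+* K))
      (g : Y ⟶ (⨁ fun j ↦ A (i j)).X) (t : complexBetti (⨁ fun j ↦ A (i j)).X (2 * p)),
      (∀ s : K →+* ℂ, {j : Fin (2 * p) | s ∈ (PicardCM.CMCode.cmTypeMap (e j) (Φ (i j))).1}.ncard = p) ∧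
      IsRationalClass t ∧
      IsOfHodgeType (⨁ fun j ↦ A (i j)).dim (⨁ fun j ↦ A (i j)).X (2 * p) p p t ∧
      t ∈ weilLineClasses (fun j ↦ A (i j))
        (fun j ↦ (ι (i j)).comp (RingOfIntegers.mapRingEquiv (e j).symm).toRingHom) (2 * p) ∧
      x = complexBetti.map g (2 * p) t}

variable (m : ℕ) (X : Motives.SchemeOver ℂ)

/-- **The system `G^W` fixes**: on the power `X^{×(a+1)}`, the Lefschetz classes ("divisor classes", read
multiplicatively as in Milne 1999 Def. 4.3: `lefschetzPowClasses`) together with the pulled-back split Weil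
classes of the CM family (`weilPullbackClasses` on `X^{×(a+1)}`) — "divisor classes and split Weil classes
on all […] powers". [cite: Milne2020HodgeClassesAV, §4 (definition of G^W)] [cite: Milne1999LefschetzClasses, Def. 4.3 (p. 659)] -/
def weilPowClasses : ∀ a p : ℕ, Set (complexBetti (cartesianPow X (a + 1)) (2 * p)) :=
  fun a p ↦ lefschetzPowClasses m X a p ∪ weilPullbackClasses A Φ ι (cartesianPow X (a + 1)) p

/-- **`G^W(ℂ)`, Tannaka-free, on the real carriers** (Milne 2020 §4: "the algebraic subgroup of
`GL_{H¹(A_𝒮,ℚ)}` fixing all […] divisor classes and split Weil classes on all products of powers of the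
`A_Φ`"; Deligne 1982 §5): the subgroup of `∏ₖ GL(Hᵏ(X(ℂ); ℂ))` of the `g` whose Künneth extension to the
powers `X^{×(a+1)}` FIXES every class of `weilPowClasses A Φ ι m X` — for `X = (⨁ A).X`, `m = (⨁ A).dim`
this is `G^W(ℂ)` (module docstring, "Identification"). [cite: Milne2020HodgeClassesAV, §4 Theorem 2] [cite: Deligne1982HodgeCycles, §5] -/
def weilStabilizer : Subgroup (∀ k : ℕ, complexBetti X k ≃ₗ[ℂ] complexBetti X k) :=
  powClassStabilizer X (weilPowClasses A Φ ι m X)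

/-- The `GL × 𝔾_m` form of `G^W`: the Künneth extension acts on every class of `weilPowClasses` of degree
`2p` by `cᵖ` for one `c ∈ ℂˣ` (the convention of Milne 1999 Def. 4.3 for `L(A)` and of the tree's
`mumfordTateGroup`). [cite: Milne1999LefschetzClasses, Def. 4.3 (p. 659)] [cite: Milne2020HodgeClassesAV, §4 Theorem 2] -/
def weilSimilitudeGroup : Subgroup (∀ k : ℕ, complexBetti X k ≃ₗ[ℂ] complexBetti X k) :=
  powClassSimilitudeGroup X (weilPowClasses A Φ ι m X)

variable {A Φ ι m X}

/-- Membership in `weilPullbackClasses`, unfolded. [cite: Milne2020HodgeClassesAV, §4 Theorem 2 (proof)] -/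
theorem mem_weilPullbackClasses_iff {Y : Motives.SchemeOver ℂ} {p : ℕ} {x : complexBetti Y (2 * p)} :
    x ∈ weilPullbackClasses A Φ ι Y p ↔
      ∃ (i : Fin (2 * p) → Fin n) (e : Fin (2 * p) → (K ≃+* K))
        (g : Y ⟶ (⨁ fun j ↦ A (i j)).X) (t : complexBetti (⨁ fun j ↦ A (i j)).X (2 * p)),
        (∀ s : K →+* ℂ, {j : Fin (2 * p) | s ∈ (PicardCM.CMCode.cmTypeMap (e j) (Φ (i j))).1}.ncard = p) ∧
        IsRationalClass t ∧
        IsOfHodgeType (⨁ fun j ↦ A (i j)).dim (⨁ fun j ↦ A (i j)).X (2 * p) p p t ∧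
        t ∈ weilLineClasses (fun j ↦ A (i j))
          (fun j ↦ (ι (i j)).comp (RingOfIntegers.mapRingEquiv (e j).symm).toRingHom) (2 * p) ∧
        x = complexBetti.map g (2 * p) t :=
  Iff.rfl

/-- The generating class `g^* t` lies in `weilPullbackClasses`. [cite: Milne2020HodgeClassesAV, §4 Theorem 2 (proof)] -/
theorem map_mem_weilPullbackClasses {Y : Motives.SchemeOver ℂ} {p : ℕ} (i : Fin (2 * p) → Fin n)
    (e : Fin (2 * p) → (K ≃+* K)) (g : Y ⟶ (⨁ fun j ↦ A (i j)).X)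
    {t : complexBetti (⨁ fun j ↦ A (i j)).X (2 * p)}
    (hsum : ∀ s : K →+* ℂ, {j : Fin (2 * p) | s ∈ (PicardCM.CMCode.cmTypeMap (e j) (Φ (i j))).1}.ncard = p)
    (htQ : IsRationalClass t)
    (htH : IsOfHodgeType (⨁ fun j ↦ A (i j)).dim (⨁ fun j ↦ A (i j)).X (2 * p) p p t)
    (htW : t ∈ weilLineClasses (fun j ↦ A (i j))
      (fun j ↦ (ι (i j)).comp (RingOfIntegers.mapRingEquiv (e j).symm).toRingHom) (2 * p)) :
    complexBetti.map g (2 * p) t ∈ weilPullbackClasses A Φ ι Y p :=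
  ⟨i, e, g, t, hsum, htQ, htH, htW, rfl⟩

/-- **Pulled-back split Weil classes are pulled-back along further morphisms**: `h^*(g^* t) = (h ≫ g)^* t`,
so `h^*` maps `weilPullbackClasses … Y` into `weilPullbackClasses … Y'` for `h : Y' ⟶ Y`. [cite: Milne2020HodgeClassesAV, §4 Theorem 2 (proof)] -/
theorem map_mem_weilPullbackClasses_of_mem {Y Y' : Motives.SchemeOver ℂ} (h : Y' ⟶ Y) {p : ℕ}
    {x : complexBetti Y (2 * p)} (hx : x ∈ weilPullbackClasses A Φ ι Y p) :
    complexBetti.map h (2 * p) x ∈ weilPullbackClasses A Φ ι Y' p := by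
  obtain ⟨i, e, g, t, hsum, htQ, htH, htW, rfl⟩ := hx
  refine ⟨i, e, h ≫ g, t, hsum, htQ, htH, htW, ?_⟩
  rw [complexBetti.map_comp]
  rfl

/-- **"Weil classes are Hodge classes"**, pulled back: on a smooth projective `Y` of dimension `m'`, every
class of `weilPullbackClasses A Φ ι Y p` is a rational class of Hodge type `(p,p)` — `t` is rational of type
`(p,p)` on the (smooth projective) abelian variety `B_Δ`, and pull-backs along morphisms of smooth projective
varieties preserve rationality and Hodge types (`IsRationalClass.pullback`,
`IsOfHodgeType.map_of_isSmoothProjective`). [cite: Milne2020HodgeClassesAV, §4 Theorem 2 (proof: "divisor classes and Weil classes are Hodge classes")] -/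
theorem weilPullbackClasses_subset_hodgeClasses {m' : ℕ} {Y : Motives.SchemeOver ℂ}
    (hY : Motives.IsSmoothProjective m' Y) (p : ℕ) :
    weilPullbackClasses A Φ ι Y p ⊆
      {c : complexBetti Y (2 * p) | IsRationalClass c ∧ IsOfHodgeType m' Y (2 * p) p p c} := by
  rintro _ ⟨i, e, g, t, -, htQ, htH, -, rfl⟩
  exact ⟨htQ.pullback _, htH.map_of_isSmoothProjective hY AbelianVariety.isSmoothProjective_holds g⟩

/-- The Lefschetz system is part of the system `G^W` fixes ("divisor classes and …").
[cite: Milne2020HodgeClassesAV, §4 (definition of G^W)] -/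
theorem lefschetzPowClasses_subset_weilPowClasses (a p : ℕ) :
    lefschetzPowClasses m X a p ⊆ weilPowClasses A Φ ι m X a p :=
  Set.subset_union_left

/-- The pulled-back split Weil classes of the power `X^{×(a+1)}` are part of the system `G^W` fixes
("… and split Weil classes"). [cite: Milne2020HodgeClassesAV, §4 (definition of G^W)] -/
theorem weilPullbackClasses_subset_weilPowClasses (a p : ℕ) :
    weilPullbackClasses A Φ ι (cartesianPow X (a + 1)) p ⊆ weilPowClasses A Φ ι m X a p :=
  Set.subset_union_right

/-- **"As divisor classes and Weil classes are Hodge classes"**: on every power of a smooth projective `X`,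
the system `G^W` fixes lies in the `ℂ`-span of the rational `(p,p)`-classes
(`lefschetzPowClasses_subset_span_hodgePowClasses` and `weilPullbackClasses_subset_hodgeClasses` on the
smooth projective power `X^{×(a+1)}`). [cite: Milne2020HodgeClassesAV, §4 Theorem 2 (proof)] -/
theorem weilPowClasses_subset_span_hodgePowClasses (hX : Motives.IsSmoothProjective m X) (a p : ℕ) :
    weilPowClasses A Φ ι m X a p ⊆ (Submodule.span ℂ (hodgePowClasses m X a p) : Set _) := by
  rintro x (hx | hx)
  · exact lefschetzPowClasses_subset_span_hodgePowClasses hX a p hx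
  · exact Submodule.subset_span
      (weilPullbackClasses_subset_hodgeClasses (isSmoothProjective_cartesianPow hX a) p hx)

/-! ### `G^H ≤ G^W ≤ S(A)` -/

/-- `G^W ≤ G^W` in the two conventions: the stabiliser is contained in the similitude group. [cite: Milne1999LefschetzClasses, p. 659 (kernel of l(A))] -/
theorem weilStabilizer_le_weilSimilitudeGroup :
    weilStabilizer A Φ ι m X ≤ weilSimilitudeGroup A Φ ι m X :=
  powClassStabilizer_le_powClassSimilitudeGroup

/-- **"Certainly `G^H ⊂ G^W`"** (Milne 2020, proof of Thm. 2): fixing all rational `(p,p)`-classes on all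
powers fixes their `ℂ`-spans, which contain the system `G^W` fixes; for every smooth projective `X`.
[cite: Milne2020HodgeClassesAV, §4 Theorem 2 (proof)] -/
theorem hodgeGroup_le_weilStabilizer (hX : Motives.IsSmoothProjective m X) :
    hodgeGroup m X ≤ weilStabilizer A Φ ι m X := by
  rw [hodgeGroup, ← powClassStabilizer_span]
  exact powClassStabilizer_anti (weilPowClasses_subset_span_hodgePowClasses hX)

/-- `MT ≤ G^W` in the `GL × 𝔾_m` convention. [cite: Milne2020HodgeClassesAV, §4 Theorem 2 (proof)] -/
theorem mumfordTateGroup_le_weilSimilitudeGroup (hX : Motives.IsSmoothProjective m X) :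
    mumfordTateGroup m X ≤ weilSimilitudeGroup A Φ ι m X := by
  rw [mumfordTateGroup, ← powClassSimilitudeGroup_span]
  exact powClassSimilitudeGroup_anti (weilPowClasses_subset_span_hodgePowClasses hX)

/-- **`G^W ≤ S(A)`**: `G^W` fixes in particular every Lefschetz class on every power, so it lies in Milne's
special Lefschetz group `specialLefschetzGroup` (stabilisers are antitone). [cite: Milne2020HodgeClassesAV, §4 (definition of G^W)] [cite: Milne1999LefschetzClasses, Def. 4.3 and p. 659] -/
theorem weilStabilizer_le_specialLefschetzGroup :
    weilStabilizer A Φ ι m X ≤ specialLefschetzGroup m X :=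
  powClassStabilizer_anti (lefschetzPowClasses_subset_weilPowClasses (A := A) (Φ := Φ) (ι := ι))

/-- `G^W ≤ L(A)` in the `GL × 𝔾_m` convention. [cite: Milne1999LefschetzClasses, Def. 4.3 (p. 659)] -/
theorem weilSimilitudeGroup_le_lefschetzGroup :
    weilSimilitudeGroup A Φ ι m X ≤ lefschetzGroup m X :=
  powClassSimilitudeGroup_anti (lefschetzPowClasses_subset_weilPowClasses (A := A) (Φ := Φ) (ι := ι))

/-- The weight cocharacter lies in the similitude form of `G^W` (it lies in every similitude group).
[cite: Milne1999LefschetzClasses, p. 659 (cocharacter w)] -/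
theorem weightCocharacter_mem_weilSimilitudeGroup (c : ℂˣ) :
    weightCocharacter X c ∈ weilSimilitudeGroup A Φ ι m X :=
  weightCocharacter_mem_powClassSimilitudeGroup c

/-- **`G^W` fixes the pulled-back split Weil classes of `X` itself** ("`G^W` fixes the elements of
`f_Δ^*(W_F(A_Δ))`"; the `a = 0` member of the Künneth family is `g`). [cite: Milne2020HodgeClassesAV, §4 Theorem 2 (proof)] -/
theorem apply_eq_self_of_mem_weilStabilizer {g : ∀ k : ℕ, complexBetti X k ≃ₗ[ℂ] complexBetti X k}
    (hg : g ∈ weilStabilizer A Φ ι m X) {p : ℕ} {x : complexBetti X (2 * p)}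
    (hx : x ∈ weilPullbackClasses A Φ ι X p) : g (2 * p) x = x :=
  apply_eq_self_of_mem_powClassStabilizer hg (p := p)
    (show x ∈ weilPowClasses A Φ ι m X 0 p from Or.inr hx)

/-- `G^W` fixes the Lefschetz classes of `X` itself. [cite: Milne2020HodgeClassesAV, §4 (definition of G^W)] -/
theorem apply_eq_self_of_mem_weilStabilizer_of_mem_divisorClassesSpan
    {g : ∀ k : ℕ, complexBetti X k ≃ₗ[ℂ] complexBetti X k} (hg : g ∈ weilStabilizer A Φ ι m X) {p : ℕ}
    {x : complexBetti X (2 * p)} (hx : x ∈ divisorClassesSpan X m p) : g (2 * p) x = x :=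
  apply_eq_self_of_mem_specialLefschetzGroup (weilStabilizer_le_specialLefschetzGroup hg) hx

end WeilSystem

/-! ### Theorem 2: `G^H = G^W` for a product of CM-typed realisations over one Galois CM field -/

section TheoremTwo

variable {K : Type} [Field K] [NumberField K] [IsCMField K] [IsGalois ℚ K]
variable {n : ℕ} {A : Fin n → AbelianVariety ℂ} {Φ : Fin n → CMType K} {ι : ∀ i, 𝓞 K →+* End (A i)}
  {θ : ∀ i, K →+* Module.End ℂ (complexBetti (A i).X 1)}

/-- **The Hodge classes of anything isomorphic to a flat product of members of the family are spanned by
pulled-back split Weil classes** (Milne: "`f_Δ^*(W_F(A_Δ))` […] these span the Hodge classes", i.e.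
Theorem 1 = André, in the tree's product form `h𝔄`, transported): if `C ≅ ⨁_{j<m'} A_{κ j}` as abelian
varieties, then every rational `(p,p)`-class on `C` lies in the `ℂ`-span of `weilPullbackClasses A Φ ι C.X p`.
The class is pulled back to the flat biproduct along `ψ⁻¹` (rational and of type `(p,p)` there: both are
smooth projective), decomposed there by the record as `Σ λ f_Δ^* t`, and pulled back along `ψ`:
`ψ^*(f_Δ^* t) = (ψ ≫ f_Δ)^* t`. Stated with the carrier `Y = C.X` and the dimension `N = C.dim`
generalised, for use on the powers. [cite: Milne2020HodgeClassesAV, §4 Theorem 2 (proof) and Theorem 1] -/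
theorem hodgeClasses_subset_span_weilPullbackClasses_of_iso
    (h𝔄 : Andre1992_hodgeClasses_cmTypedProduct_mem_span_pullback_weilLines)
    (hA : ∀ i, IsCMTypeRealisation (Φ i) (A i) (ι i) (θ i)) {m' : ℕ} (κ : Fin m' → Fin n)
    (C : AbelianVariety ℂ) (ψ : C ≅ ⨁ fun j ↦ A (κ j)) {Y : Motives.SchemeOver ℂ} {N : ℕ}
    (hY : C.X = Y) (hN : C.dim = N) (p : ℕ) :
    {c : complexBetti Y (2 * p) | IsRationalClass c ∧ IsOfHodgeType N Y (2 * p) p p c} ⊆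
      (Submodule.span ℂ (weilPullbackClasses A Φ ι Y p) : Set _) := by
  subst hY hN
  rintro c ⟨hcQ, hcH⟩
  -- the class on the flat biproduct: `c₂ = (ψ⁻¹)^* c`, rational and of type `(p,p)` there
  have hc₂Q : IsRationalClass (complexBetti.map ψ.inv.hom.hom.hom (2 * p) c) := hcQ.pullback _
  have hc₂H : IsOfHodgeType (⨁ fun j ↦ A (κ j)).dim (⨁ fun j ↦ A (κ j)).X (2 * p) p p
      (complexBetti.map ψ.inv.hom.hom.hom (2 * p) c) :=
    hcH.map_of_isSmoothProjective AbelianVariety.isSmoothProjective_holds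
      AbelianVariety.isSmoothProjective_holds _
  -- André's record on the flat family
  have hspan := h𝔄 K m' (fun j ↦ A (κ j)) (fun j ↦ Φ (κ j)) (fun j ↦ ι (κ j)) (fun j ↦ θ (κ j))
    (fun j ↦ hA (κ j)) p _ hc₂Q hc₂H
  -- pull back along `ψ`: `ψ^* ((ψ⁻¹)^* c) = c`
  have hc : (complexBetti.map ψ.hom.hom.hom.hom (2 * p)).hom
      (complexBetti.map ψ.inv.hom.hom.hom (2 * p) c) = c := by
    change (complexBetti.map ψ.inv.hom.hom.hom (2 * p) ≫ complexBetti.map ψ.hom.hom.hom.hom (2 * p)) c = c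
    rw [← complexBetti.map_comp]
    change complexBetti.map (ψ.hom ≫ ψ.inv).hom.hom.hom (2 * p) c = c
    rw [ψ.hom_inv_id]
    change complexBetti.map (𝟙 C.X) (2 * p) c = c
    rw [complexBetti.map_id]
    rfl
  have himage := Submodule.mem_map_of_mem (f := (complexBetti.map ψ.hom.hom.hom.hom (2 * p)).hom) hspan
  rw [Submodule.map_span, hc] at himage
  refine Submodule.span_mono ?_ himage
  rintro _ ⟨_, ⟨i, e, t, -, hsum, htQ, htH, htW, rfl⟩, rfl⟩
  refine ⟨fun j ↦ κ (i j), e, (ψ.hom ≫ multiDiagonal (fun j ↦ A (κ j)) i).hom.hom.hom, t, hsum, htQ, htH,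
    htW, ?_⟩
  change _ = complexBetti.map (ψ.hom.hom.hom.hom ≫ (multiDiagonal (fun j ↦ A (κ j)) i).hom.hom.hom) (2 * p) t
  rw [complexBetti.map_comp]
  rfl

variable (Φ ι) in
/-- **The Hodge classes of every power `B^{a+1}` of `B = ⨁_{i<n} A_i` are spanned by the system `G^W` fixes**
("As these span the Hodge classes"): `hodgePowClasses B.dim B.X a p ⊆ span (weilPowClasses … a p)`, through
the flattening isomorphism `powFlatIso` and the identifications `(B.powSucc a).X = B.X^{×(a+1)}`,
`(B.powSucc a).dim = cartesianPowDim B.dim a` of `Milne1999/LefschetzGroup`. [cite: Milne2020HodgeClassesAV, §4 Theorem 2 (proof)] -/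
theorem hodgePowClasses_subset_span_weilPowClasses
    (h𝔄 : Andre1992_hodgeClasses_cmTypedProduct_mem_span_pullback_weilLines)
    (hA : ∀ i, IsCMTypeRealisation (Φ i) (A i) (ι i) (θ i)) (a p : ℕ) :
    hodgePowClasses (⨁ A).dim (⨁ A).X a p ⊆
      (Submodule.span ℂ (weilPowClasses A Φ ι (⨁ A).dim (⨁ A).X a p) : Set _) :=
  fun _ hc ↦ Submodule.span_mono (weilPullbackClasses_subset_weilPowClasses a p)
    (hodgeClasses_subset_span_weilPullbackClasses_of_iso h𝔄 hA (flatIndex a) ((⨁ A).powSucc a)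
      (powFlatIso A a) ((⨁ A).powSucc_X_eq_cartesianPow a) ((⨁ A).dim_powSucc_eq_cartesianPowDim a) p hc)

variable (Φ ι) in
/-- **Milne 2020, Theorem 2 (= Deligne 1982 §5, the original form of André's theorem): `G^H = G^W`**, for the
product `B = ⨁_{i<n} A_i` of realisations `(A_i, ι_i, θ_i)` of CM types `Φ_i` of one CM field `K` Galois over
`ℚ` (Milne's `A_𝒮` when `Φ` runs through all CM types of `K`), on the real carriers: the subgroup of
`∏ₖ GL(Hᵏ(B(ℂ); ℂ))` fixing all rational `(p,p)`-classes on all powers EQUALS the subgroup fixing the divisor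
classes and the pulled-back split Weil classes on all powers. `≤`: `hodgeGroup_le_weilStabilizer`; `≥`: the
system `G^W` fixes spans the Hodge classes of every power (`hodgePowClasses_subset_span_weilPowClasses`,
i.e. Theorem 1 = the tree's André record `h𝔄`, DISCHARGED in the tree by
`Summit.HodgeConjecture.CorCM.AndreProductForm.andre1992_hodgeClasses_cmTypedProduct_mem_span_pullback_weilLines_holds`)
and fixing a set or its span is the same (`powClassStabilizer_span`).
[cite: Milne2020HodgeClassesAV, §4 Theorem 2] [cite: Deligne1982HodgeCycles, §5] [cite: Andre1992HodgeCM, §4 Théorème] -/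
theorem hodgeGroup_eq_weilStabilizer
    (h𝔄 : Andre1992_hodgeClasses_cmTypedProduct_mem_span_pullback_weilLines)
    (hA : ∀ i, IsCMTypeRealisation (Φ i) (A i) (ι i) (θ i)) :
    hodgeGroup (⨁ A).dim (⨁ A).X = weilStabilizer A Φ ι (⨁ A).dim (⨁ A).X := by
  refine le_antisymm (hodgeGroup_le_weilStabilizer AbelianVariety.isSmoothProjective_holds) ?_
  rw [weilStabilizer, ← powClassStabilizer_span, hodgeGroup]
  exact powClassStabilizer_anti (hodgePowClasses_subset_span_weilPowClasses Φ ι h𝔄 hA)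

variable (Φ ι) in
/-- **Theorem 2 in the `GL × 𝔾_m` convention**: `MT(B) = ` the similitude form of `G^W` (both are `w(ℂˣ) ·`
the groups of `hodgeGroup_eq_weilStabilizer`, `powClassSimilitudeGroup_eq_of_powClassStabilizer_eq`).
[cite: Milne2020HodgeClassesAV, §4 Theorem 2] [cite: Milne1999LefschetzClasses, Def. 4.3 and p. 659] -/
theorem mumfordTateGroup_eq_weilSimilitudeGroup
    (h𝔄 : Andre1992_hodgeClasses_cmTypedProduct_mem_span_pullback_weilLines)
    (hA : ∀ i, IsCMTypeRealisation (Φ i) (A i) (ι i) (θ i)) :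
    mumfordTateGroup (⨁ A).dim (⨁ A).X = weilSimilitudeGroup A Φ ι (⨁ A).dim (⨁ A).X :=
  powClassSimilitudeGroup_eq_of_powClassStabilizer_eq (hodgeGroup_eq_weilStabilizer Φ ι h𝔄 hA)

variable (Φ ι) in
/-- **Corollary (the use of Theorem 2): a class fixed by `G^W` is fixed by the Hodge group.** On
`B = ⨁ A_i`, a class of `H²ᵖ(B(ℂ); ℂ)` fixed by every element of `G^W(ℂ)` is fixed by every element of
`Hg′(B)(ℂ)` — and conversely — since the two groups coincide; combined with "`Hg′`-invariants are Hodge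
classes" (Deligne 1982, 3.1 (c)/3.4 on `ℚ`-structures; not in the tree on these carriers) this is how
Deligne–Milne read algebraicity statements off `G^W`. [cite: Milne2020HodgeClassesAV, §4 Theorem 2] [cite: Deligne1982HodgeCycles, §5 and I Prop. 3.1] -/
theorem forall_mem_weilStabilizer_apply_eq_iff
    (h𝔄 : Andre1992_hodgeClasses_cmTypedProduct_mem_span_pullback_weilLines)
    (hA : ∀ i, IsCMTypeRealisation (Φ i) (A i) (ι i) (θ i)) {k : ℕ} (x : complexBetti (⨁ A).X k) :
    (∀ g ∈ weilStabilizer A Φ ι (⨁ A).dim (⨁ A).X, g k x = x) ↔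
      ∀ g ∈ hodgeGroup (⨁ A).dim (⨁ A).X, g k x = x := by
  rw [hodgeGroup_eq_weilStabilizer Φ ι h𝔄 hA]

variable (Φ ι) in
/-- **`Hg′(B) = G^W ≤ S(B)` with equality of the first two**: under Theorem 2 the chain
`hodgeGroup ≤ weilStabilizer ≤ specialLefschetzGroup` of this file collapses its first step; the second step
is Milne 1999 Prop. 4.8's comparison `Hg′ ≤ S` (exotic = non-Lefschetz Hodge classes, e.g. the split Weil
classes themselves when `p ≥ 2`). [cite: Milne2020HodgeClassesAV, §4 Theorem 2] [cite: Milne1999LefschetzClasses, Prop. 4.8 (p. 660)] -/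
theorem hodgeGroup_le_weilStabilizer_le_specialLefschetzGroup
    (h𝔄 : Andre1992_hodgeClasses_cmTypedProduct_mem_span_pullback_weilLines)
    (hA : ∀ i, IsCMTypeRealisation (Φ i) (A i) (ι i) (θ i)) :
    hodgeGroup (⨁ A).dim (⨁ A).X = weilStabilizer A Φ ι (⨁ A).dim (⨁ A).X ∧
      weilStabilizer A Φ ι (⨁ A).dim (⨁ A).X ≤ specialLefschetzGroup (⨁ A).dim (⨁ A).X :=
  ⟨hodgeGroup_eq_weilStabilizer Φ ι h𝔄 hA, weilStabilizer_le_specialLefschetzGroup⟩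

end TheoremTwo

end Literature.AlgebraicGeometry.Milne1999

end
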